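import Summits.Ventures.CertifiedManyBodySolver.Theorems.R2cBoxSpinConsumer
import Summits.Ventures.CertifiedManyBodySolver.Theorems.R2cAssembly
import Summits.Ventures.CertifiedManyBodySolver.Upper.FMPSConsumer

/-!
# Route `R2cOpenStripTangentLine` — F1-standard 2-D MPS consumer for the cruxes `RightFamilyBelowLine`
(stmt-Ventures-19262) and `LeftFamilyBelowLine` (stmt-Ventures-19263)

HONEST FRAMING: first certified bounds; not a superconductivity verdict; every number certified or labelled float.
NO NUMBER IS CLAIMED HERE: every crux-valued theorem below is an implication from the data + sentence a producer's
FORMAT-mps1-class certificate would assert (`proof.conditional` by design).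

The verbatim 2-D transposition of the 1-D consumer `Upper.m1DopedEnergyUpperRow_of_fmps_cert_blocks`: an open-boundary
MPS with SITE-DEPENDENT tensors `A : Fin (a·b) → MPSTensor 4 D` (`Upper.mpsOpenVar (a*b) A l r`) read along ANY enumeration
`e : Fin (a·b) ≃ Fin a ×ₗ Fin b` of the open `a × b` box (row-major snake: `finProdFinEquiv.symm.trans toLex`; column
order, boustrophedon, … are all admitted — the Jordan–Wigner signs live in `toSpin (hubbardOpenBoxTT' a b 1 0 8)` w.r.t.
the Lex order and are the producer's to evaluate), its bond-charge labels `c` (FORMAT block structure F-V2, checked exactly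
by the readers ⇒ the amplitude vanishes off total site-charge `N`, `mpsOpenVar_comp_equiv_eq_zero_of_charge`), `ψ ≠ 0`,
and the certificate sentence `Re⟨ψ, toSpin(H_open(a×b;1,0,8)) ψ⟩ ≤ E·Re⟨ψ, ψ⟩` give — through the LANDED route item
`BoxSpinConsumer` (`Theorems.boxSpinConsumer_proof`, p443672) — the undressed all-`k` family and hence the crux of the
window containing `N/(ab)` when `E/(ab)` is below the tangent line `ℓ(n) = -18/25 + (8/5)(n − 7/8)`; at filling exactly
`7/8` both cruxes and the rung leaf `MbsolverRungLeaves.M3Upper_tp0_le_m18o25` (via `Theorems.r2cAssembly_proof`).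
No new definition: the pulled-back trial vector is written `fun k => mpsOpenVar (a*b) A l r (fun i => k (e i))`.
Adapted from the route pen's sketch `BoxMpsConsumerSketch.lean` (sr-mbsolver-var-7 g12, evidence on both items, sha16
896489c3c69dc6ed), generalised from the row-major snake to an arbitrary enumeration `e`.
-/

noncomputable section

open Matrix Finset
open scoped ComplexOrder BigOperators

namespace Summit.Ventures.CertifiedManyBodySolver.Theorems

open Literature.MathematicalPhysics.QuantumLattice
open Summit.Ventures.CertifiedManyBodySolver.Upper
open Summit.Ventures.CertifiedManyBodySolver.Theses.R2cOpenStripTangentLine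

/-- **F-L2 along an enumeration.** Bond-charge labels of a site-dependent open MPS of length `L` read along ANY
enumeration `e : Fin L ≃ Λ` of a finite site set force the pulled-back amplitude `k ↦ ψ(k ∘ e)` to vanish off total
site-charge `N₀` (transport of `Upper.mpsOpenVar_eq_zero_of_charge` by `Equiv.sum_comp`). [folklore] -/
theorem mpsOpenVar_comp_equiv_eq_zero_of_charge {Λ : Type*} [Fintype Λ] (L : ℕ) (e : Fin L ≃ Λ) {D : ℕ}
    (A : Fin L → MPSTensor 4 D) (l r : Fin D → ℂ) (N₀ : ℕ) (c : Fin (L + 1) → Fin D → ℕ)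
    (hl : ∀ α, l α ≠ 0 → c 0 α = 0) (hr : ∀ β, r β ≠ 0 → c (Fin.last L) β = N₀)
    (hA : ∀ (j : Fin L) (s : Fin 4) (α β : Fin D), A j s α β ≠ 0 → c j.succ β = c j.castSucc α + siteCharge s) :
    ∀ k : TensorIndex Λ 4, (∑ x, siteCharge (k x)) ≠ N₀ → mpsOpenVar L A l r (fun i => k (e i)) = 0 := by
  intro k hk
  apply mpsOpenVar_eq_zero_of_charge L A l r N₀ c hl hr hA
  rw [Equiv.sum_comp e (fun x => siteCharge (k x))]
  exact hk

/-- **F1-standard 2-D consumer, rank-2 crux.** An open MPS certificate with block data on ONE open `a × b` box at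
`(t,t′,U) = (1,0,8)` read along the enumeration `e`, `N` in the right window `[7/8, 1]·ab`, `E/(ab)` below the tangent line
⇒ `RightFamilyBelowLine` (`Δ = 0`), through the landed `BoxSpinConsumer`. [folklore] -/
theorem rightFamilyBelowLine_of_boxMps_cert_blocks (a b N : ℕ) (e : Fin (a * b) ≃ (Fin a ×ₗ Fin b)) {D : ℕ}
    (A : Fin (a * b) → MPSTensor 4 D) (l r : Fin D → ℂ) (E : ℚ) (ha : 1 ≤ a) (hb : 1 ≤ b)
    (hlo : (7 / 8 : ℚ) * ((a : ℚ) * (b : ℚ)) ≤ (N : ℚ)) (hhi : (N : ℚ) ≤ (a : ℚ) * (b : ℚ))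
    (hbar : E / ((a : ℚ) * (b : ℚ)) ≤ -18 / 25 + 8 / 5 * ((N : ℚ) / ((a : ℚ) * (b : ℚ)) - 7 / 8))
    (c : Fin (a * b + 1) → Fin D → ℕ)
    (hl : ∀ α, l α ≠ 0 → c 0 α = 0) (hr : ∀ β, r β ≠ 0 → c (Fin.last (a * b)) β = N)
    (hA : ∀ (j : Fin (a * b)) (s : Fin 4) (α β : Fin D), A j s α β ≠ 0 → c j.succ β = c j.castSucc α + siteCharge s)
    (hne : (fun k : TensorIndex (Fin a ×ₗ Fin b) 4 => mpsOpenVar (a * b) A l r (fun i => k (e i))) ≠ 0)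
    (hE : (star (fun k : TensorIndex (Fin a ×ₗ Fin b) 4 => mpsOpenVar (a * b) A l r (fun i => k (e i))) ⬝ᵥ
            (JordanWigner.toSpin (hubbardOpenBoxTT' a b 1 0 8) *ᵥ
              (fun k : TensorIndex (Fin a ×ₗ Fin b) 4 => mpsOpenVar (a * b) A l r (fun i => k (e i))))).re
          ≤ (E : ℝ) * (star (fun k : TensorIndex (Fin a ×ₗ Fin b) 4 => mpsOpenVar (a * b) A l r (fun i => k (e i))) ⬝ᵥ
            (fun k : TensorIndex (Fin a ×ₗ Fin b) 4 => mpsOpenVar (a * b) A l r (fun i => k (e i)))).re) :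
    RightFamilyBelowLine := by
  have hNab : N ≤ a * b := by
    have : (N : ℚ) ≤ ((a * b : ℕ) : ℚ) := by push_cast; exact hhi
    exact_mod_cast this
  have hfam := boxSpinConsumer_proof a b N _ E ha hb hNab
    (mpsOpenVar_comp_equiv_eq_zero_of_charge (a * b) e A l r N c hl hr hA) hne hE
  refine ⟨a, b, N, E, 0, ha, hb, hlo, hhi, by simpa using hbar, ?_⟩
  intro k hk
  simpa using hfam k hk

/-- **F1-standard 2-D consumer, rank-3 crux** (left window `[3/4, 7/8]·ab`). [folklore] -/
theorem leftFamilyBelowLine_of_boxMps_cert_blocks (a b N : ℕ) (e : Fin (a * b) ≃ (Fin a ×ₗ Fin b)) {D : ℕ}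
    (A : Fin (a * b) → MPSTensor 4 D) (l r : Fin D → ℂ) (E : ℚ) (ha : 1 ≤ a) (hb : 1 ≤ b)
    (hlo : (3 / 4 : ℚ) * ((a : ℚ) * (b : ℚ)) ≤ (N : ℚ)) (hhi : (N : ℚ) ≤ (7 / 8 : ℚ) * ((a : ℚ) * (b : ℚ)))
    (hbar : E / ((a : ℚ) * (b : ℚ)) ≤ -18 / 25 + 8 / 5 * ((N : ℚ) / ((a : ℚ) * (b : ℚ)) - 7 / 8))
    (c : Fin (a * b + 1) → Fin D → ℕ)
    (hl : ∀ α, l α ≠ 0 → c 0 α = 0) (hr : ∀ β, r β ≠ 0 → c (Fin.last (a * b)) β = N)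
    (hA : ∀ (j : Fin (a * b)) (s : Fin 4) (α β : Fin D), A j s α β ≠ 0 → c j.succ β = c j.castSucc α + siteCharge s)
    (hne : (fun k : TensorIndex (Fin a ×ₗ Fin b) 4 => mpsOpenVar (a * b) A l r (fun i => k (e i))) ≠ 0)
    (hE : (star (fun k : TensorIndex (Fin a ×ₗ Fin b) 4 => mpsOpenVar (a * b) A l r (fun i => k (e i))) ⬝ᵥ
            (JordanWigner.toSpin (hubbardOpenBoxTT' a b 1 0 8) *ᵥ
              (fun k : TensorIndex (Fin a ×ₗ Fin b) 4 => mpsOpenVar (a * b) A l r (fun i => k (e i))))).re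
          ≤ (E : ℝ) * (star (fun k : TensorIndex (Fin a ×ₗ Fin b) 4 => mpsOpenVar (a * b) A l r (fun i => k (e i))) ⬝ᵥ
            (fun k : TensorIndex (Fin a ×ₗ Fin b) 4 => mpsOpenVar (a * b) A l r (fun i => k (e i)))).re) :
    LeftFamilyBelowLine := by
  have hab : (0 : ℚ) ≤ (a : ℚ) * (b : ℚ) := by positivity
  have hNab : N ≤ a * b := by
    have : (N : ℚ) ≤ ((a * b : ℕ) : ℚ) := by push_cast; linarith
    exact_mod_cast this
  have hfam := boxSpinConsumer_proof a b N _ E ha hb hNab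
    (mpsOpenVar_comp_equiv_eq_zero_of_charge (a * b) e A l r N c hl hr hA) hne hE
  refine ⟨a, b, N, E, 0, ha, hb, hlo, hhi, by simpa using hbar, ?_⟩
  intro k hk
  simpa using hfam k hk

/-- **F1-standard 2-D consumer at filling `7/8`: both cruxes and the rung leaf.** `8N = 7ab`, `E/(ab) ≤ -18/25`; e.g. the
width-8 open strip `8 × 32` at `N = 224` with `E ≤ -4608/25`, read along its 256-site snake. [folklore] -/
theorem bothFamiliesBelowLine_of_boxMps_cert_blocks_sevenEighths (a b N : ℕ) (e : Fin (a * b) ≃ (Fin a ×ₗ Fin b))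
    {D : ℕ} (A : Fin (a * b) → MPSTensor 4 D) (l r : Fin D → ℂ) (E : ℚ) (ha : 1 ≤ a) (hb : 1 ≤ b)
    (hN : 8 * N = 7 * (a * b)) (hbar : E / ((a : ℚ) * (b : ℚ)) ≤ -18 / 25)
    (c : Fin (a * b + 1) → Fin D → ℕ)
    (hl : ∀ α, l α ≠ 0 → c 0 α = 0) (hr : ∀ β, r β ≠ 0 → c (Fin.last (a * b)) β = N)
    (hA : ∀ (j : Fin (a * b)) (s : Fin 4) (α β : Fin D), A j s α β ≠ 0 → c j.succ β = c j.castSucc α + siteCharge s)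
    (hne : (fun k : TensorIndex (Fin a ×ₗ Fin b) 4 => mpsOpenVar (a * b) A l r (fun i => k (e i))) ≠ 0)
    (hE : (star (fun k : TensorIndex (Fin a ×ₗ Fin b) 4 => mpsOpenVar (a * b) A l r (fun i => k (e i))) ⬝ᵥ
            (JordanWigner.toSpin (hubbardOpenBoxTT' a b 1 0 8) *ᵥ
              (fun k : TensorIndex (Fin a ×ₗ Fin b) 4 => mpsOpenVar (a * b) A l r (fun i => k (e i))))).re
          ≤ (E : ℝ) * (star (fun k : TensorIndex (Fin a ×ₗ Fin b) 4 => mpsOpenVar (a * b) A l r (fun i => k (e i))) ⬝ᵥ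
            (fun k : TensorIndex (Fin a ×ₗ Fin b) 4 => mpsOpenVar (a * b) A l r (fun i => k (e i)))).re) :
    (RightFamilyBelowLine ∧ LeftFamilyBelowLine) ∧
      Summit.Ventures.CertifiedManyBodySolver.MbsolverRungLeaves.M3Upper_tp0_le_m18o25 := by
  have ha' : (0 : ℚ) < a := by exact_mod_cast ha
  have hb' : (0 : ℚ) < b := by exact_mod_cast hb
  have hab : (0 : ℚ) < (a : ℚ) * (b : ℚ) := mul_pos ha' hb'
  have hNq : (8 : ℚ) * (N : ℚ) = 7 * ((a : ℚ) * (b : ℚ)) := by exact_mod_cast hN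
  have hn : (N : ℚ) / ((a : ℚ) * (b : ℚ)) = 7 / 8 := by
    rw [div_eq_iff hab.ne']; linarith
  have hline : E / ((a : ℚ) * (b : ℚ)) ≤ -18 / 25 + 8 / 5 * ((N : ℚ) / ((a : ℚ) * (b : ℚ)) - 7 / 8) := by
    rw [hn]; norm_num at hbar ⊢; exact hbar
  have hR := rightFamilyBelowLine_of_boxMps_cert_blocks a b N e A l r E ha hb (by linarith) (by linarith) hline
    c hl hr hA hne hE
  have hL := leftFamilyBelowLine_of_boxMps_cert_blocks a b N e A l r E ha hb (by linarith) (by linarith) hline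
    c hl hr hA hne hE
  exact ⟨⟨hR, hL⟩, r2cAssembly_proof hR hL⟩

end Summit.Ventures.CertifiedManyBodySolver.Theorems

end
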